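import Mathlib.LinearAlgebra.Span.Basic
import Mathlib.Tactic
import HarnessLib

/-!
# «Projection before return» — algebraic skeleton of LEMMA (R7″)

Kernel form of `widen/W1/TOPEND-w1cx1.md` (R7″) (W1 cell pub-hsemireg, w1-cx-1 g13 pencil,
g14 leaf).  In the tensor-trick evaluation of a top-END word the slot-2 track is one tensor
factor; a slot-3 homotopy acting at a tree node applies `ip = i ∘ p` (inclusion of cohomology
representatives after projection) to the slot-2 partial product at that node.  If this happens
at a stage whose cohomology is ONE-dimensional (the `−Γ′₁` stage: `h¹(𝒪(−Γ′₁)) = 1`), then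
whatever `K`-linear operations follow on the slot-2 track (multiplication by the harmonic
return section `s_{Γ′₁}`, by units, further `ip`'s) and whatever `K`-linear root projection is
applied, the slot-2 root reading lies on ONE line — the image of the basis class.  The slot-2
reading is `K`-linear in the slot-2 factor (multilinearity of the pure-tensor evaluation), so
the statement below, about a composite of linear maps through a rank-one map, is exactly the
algebraic half of (R7″); the combinatorial half (whether an `ip` meets the track before the
return) is word-dependent and is FALSE in general (TOPEND (R10)(b′): the T5-class carrier at
`N = 14` escapes it).  The complementary case is recorded too: if the `ip` meets the track at a
stage where the track is an `h`-OUTPUT, the term dies (`p ∘ h = 0`, an SDR side condition), so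
on such words the confinement mechanism is void rather than violated ((R10)(b′)).  Pure linear
algebra over a commutative ring; nothing here is a statement about the Hodge conjecture.
-/

namespace Summit.Ventures.HSemireg.ProjectionBeforeReturn

variable {K V W U : Type*} [CommRing K] [AddCommGroup V] [Module K V] [AddCommGroup W]
  [Module K W] [AddCommGroup U] [Module K U]

/-- The inclusion of representatives `i : K →ₗ V` of a one-dimensional cohomology is
multiplication of its basis class `i 1` : `i c = c • i 1`. -/
theorem incl_eq_smul_basis (i : K →ₗ[K] V) (c : K) : i c = c • i 1 := by
  rw [← map_smul, smul_eq_mul, mul_one]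

/-- **Projection before return (algebraic half of (R7″)).**  If the slot-2 track `x` is hit
by `ip = i ∘ p` through a one-dimensional cohomology (`p : V →ₗ K`, `i : K →ₗ V`), then after
any `K`-linear continuation `F` (multiplication by the return section and by units, further
`ip`'s) and any `K`-linear root projection `P`, the reading is `p x` times the reading of the
basis class. -/
theorem reading_after_ip (p : V →ₗ[K] K) (i : K →ₗ[K] V) (F : V →ₗ[K] W) (P : W →ₗ[K] U)
    (x : V) : P (F (i (p x))) = p x • P (F (i 1)) := by
  rw [incl_eq_smul_basis i (p x), map_smul, map_smul]

/-- **Corollary (the line).**  Under the same hypotheses the slot-2 root reading lies in the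
line spanned by the reading of the basis class — in (R7″): `p₂(X₂) ∈ K·η_{Γ′₁}` whenever a
slot-3 homotopy projects the slot-2 track at the `−Γ′₁` stage before the return. -/
theorem reading_after_ip_mem_span (p : V →ₗ[K] K) (i : K →ₗ[K] V) (F : V →ₗ[K] W)
    (P : W →ₗ[K] U) (x : V) : P (F (i (p x))) ∈ K ∙ P (F (i 1)) := by
  rw [reading_after_ip]
  exact Submodule.smul_mem _ _ (Submodule.mem_span_singleton_self _)

/-- **Corollary (rank ≤ 1 over all tracks).**  The image of the whole slot-2 cochain group
under «project, include, continue, read» is contained in that line: every word whose every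
`(0,1,1)`-typed root term passes through such an `ip` has its slot-2 readings confined to one
line, for every basis choice (the V*-confinement mechanism of the witness family). -/
theorem range_reading_after_ip_le_span (p : V →ₗ[K] K) (i : K →ₗ[K] V) (F : V →ₗ[K] W)
    (P : W →ₗ[K] U) :
    LinearMap.range (P ∘ₗ F ∘ₗ i ∘ₗ p) ≤ K ∙ P (F (i 1)) := by
  rintro _ ⟨x, rfl⟩
  exact reading_after_ip_mem_span p i F P x

/-- **The escape is real (no lemma without the `ip`).**  Without the rank-one factor nothing
confines the reading: already for `K`-linear `G : V →ₗ U` with two readings that are not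
proportional the range is not contained in the line of either — stated here in the minimal
form used in (R10)(b′): if `G x` is not in the line of `G y` then the range of `G` is not
contained in that line. -/
theorem range_not_le_span_of_not_mem (G : V →ₗ[K] U) (x y : V) (hx : G x ∉ K ∙ G y) :
    ¬ LinearMap.range G ≤ K ∙ G y :=
  fun h => hx (h ⟨x, rfl⟩)

/-- **The complementary kill (SDR side condition `p ∘ h = 0`).**  If the slot-2 track is an
`h`-output `h y` when the slot-3 homotopy's `ip = i ∘ p` meets it, the term vanishes: there is
nothing to project.  This is why LEMMA (R7″) is VOID (not violated) on the T5-class carrier of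
TOPEND (R10)(b′), whose slot-2 track reaches the `−Γ′₁` stage as `h(β₀·h(β₁·β₂))`. -/
theorem ip_of_h_output_eq_zero {C : Type*} [AddCommGroup C] [Module K C] (p : V →ₗ[K] K)
    (i : K →ₗ[K] V) (h : C →ₗ[K] V) (ph : ∀ y, p (h y) = 0) (y : C) : i (p (h y)) = 0 := by
  rw [ph, map_zero]

/-- **Dichotomy at an `ip`.**  Reading after an `ip` that meets an `h`-output is zero, whatever
the continuation `F` and the root projection `P` — the «death» branch next to the «line» branch
`reading_after_ip_mem_span`. -/
theorem reading_after_ip_of_h_output {C : Type*} [AddCommGroup C] [Module K C] (p : V →ₗ[K] K)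
    (i : K →ₗ[K] V) (h : C →ₗ[K] V) (F : V →ₗ[K] W) (P : W →ₗ[K] U) (ph : ∀ y, p (h y) = 0)
    (y : C) : P (F (i (p (h y)))) = 0 := by
  rw [ip_of_h_output_eq_zero p i h ph, map_zero, map_zero]

end Summit.Ventures.HSemireg.ProjectionBeforeReturn
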